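import Summits.QuantumFields.YangMills.Theorems.BalabanUVNodesK0AxMomentSocketRows

/-!
# BalabanUVNodes ∕ K0ᴬ–K1ᴬ — LENS P3 §7: FINITE-VOLUME, RATE-FREE SUPPLIERS OF THE JUNCTION SOCKET's KERNEL LETTERS (every hypothesis a statement about the
# windowed torus kernels `recordPvolAx … K` or the existence of the (1.21) limit)

LANDING (porter PTC-1 g3, 2026-08-31): landed VERBATIM from the ideation cell's HOME sketch `nodeO-cover/P3-K1AxSocketPvol-v1.lean` (sha16 f48e251aff2c6c7a, 209 l.,
author seat ★ P3 gen 89, OFFER №5 08:10:37Z — the finite-volume sequel of ✓`…K0AxMomentSocketRows`) as a K0ᴬ helper `--supports stmt-QuantumFields-27238 --as helper` under the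
basename the author named (`…K0AxMomentSocketPvol`); only this paragraph was added.  CONDITIONAL helpers + one folklore analysis lemma: the four `def … : Prop` below are HYPOTHESIS
SHAPES (open, Bałaban-strength), every theorem takes them as hypotheses; nothing of [B12]∕[B13] is asserted, ported, discharged or refuted; K0ᴬ (stmt-27238) stays OPEN.

IDEATION CELL `ym-nodeO-ideate`, author seat ★ P3 («weaken the target»), gen 89 — a typed SKETCH offered to the porters (count-neutral seat; nothing here is
filed by the author).  Seventh module of the moment road; imports §6 (`…K0AxMomentSocketRows`, the module name under which sketch №4 is offered — adjust to the landed
basename).  Namespace `Summit.QuantumFields.YangMills.Theorems.K0AxMomentRoad`.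

WHAT §6 LEFT AT THE LIMIT.  §6 inhabits the junction's socket body `CofinalBetaSocketAxBody F a` from four letters on the LIMIT activities `recordPlimAx` ((L-absmom-box),
(L-cont-box), (L-dom-box), (L-negpart-box)).  Of these only (L-absmom-box) had a finite-volume supplier (`…K0AxMomentBox.recordPlimAbsMomentOnBoxAx_of_pvol`, Fatou through
the windows).  LENS P3 asks which rows SURVIVE the weakening «limit-kernel letter ↦ finite-volume letter + (1.21) existence, no rate»; this file answers: ALL OF THEM, with
one honest price tag — the SIGNED floor needs window-uniform domination (tightness), where the absolute rows needed only Fatou.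
* §7a ★ `tendsto_windowSum_of_dominated` — dominated convergence through an exhausting finite window (`Σ_{z ∈ W K} f K z → Σ'_z g z`; Mathlib's Tannery theorem
  `tendsto_tsum_of_dominated_convergence` on zero-extended window terms; the `ℤ⁴`-window twin of `T4LambdaMatching.tendsto_sum_range_of_dominated`).
* §7b FINITE-VOLUME LETTERS (windowed torus kernels, per scale, rate-free): (V-dom-ev-box) `RecordPvolMomentDominatedEvOnBoxAx` — ONE summable `m_k` dominating the moment
  terms pointwise-eventually in `K` (= `PvolDecayEvOnBoxOf` with the (5.10) rate removed); (V-cont-box) `RecordPvolContOnBoxAx` — termwise history-continuity of the torus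
  entries for cofinally many volumes (the β sub-cell's (C-fin), [I] prints nothing on history dependence but p.298); (V-ucauchy-box) `RecordPvolUniformCauchyOnBoxAx` — the
  entries are uniformly Cauchy in the volume on the box (the rate-free form of the history-uniform volume rate (VR-u) of `Beta.BetaContinuityVolume` and of lens-1's
  two-volume exponential letter [E] `K0AxTwoVolumeRate.RecordPvolTwoVolExpOnRunsAx`); (V-negpart-box) `RecordPvolMomentNegPartOnBoxAx … e` — summable negative parts of the
  SIGNED window moments for cofinally many volumes, with window-uniform domination by `m_k` built in.
* §7c FEEDING: (L-lim-box) + (V-dom-ev-box) ⟹ (L-dom-box) (`le_of_tendsto` termwise); ★ (L-lim-box) + (V-cont-box) + (V-ucauchy-box) ⟹ (L-cont-box)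
  (`UniformCauchySeqOn.tendstoUniformlyOn_of_tendsto` + `TendstoUniformlyOn.continuousOn`); ★ (L-lim-box) + (V-negpart-box e) ⟹ (L-negpart-box e) (§7a + closedness of
  `[−e_k, ∞[`, `IsClosed.mem_of_frequently_of_tendsto`); (V-negpart-box) ⟹ (V-dom-ev-box).
* §7d ★★★ `record13SepCoPHInhabitedAx_of_pvolBoxLetters_cofinalRadii` — K0ᴬ `Theses.BalabanUVNodes.Record13SepCoPHInhabitedAx` BY NAME from (L-lim-box) + (V-absmom-box) +
  (V-cont-box) + (V-ucauchy-box) + (V-negpart-box) at cofinally small radii, through §6's ★★★ `record13SepCoPHInhabitedAx_of_plimBoxLetters_cofinalRadii`.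

LENS-P3 TABLE, FINITE-VOLUME COLUMN (numbers, not adjectives): of the junction binder's rows — box lower∕upper + row (i) ⟸ (V-absmom-box) by FATOU (§5, `∃ᶠ K` bounds on
window sums of |terms|); (C) ⟸ (V-cont-box) + (V-ucauchy-box) by UNIFORM LIMIT (no rate, no decay); (iv) ⟸ (V-negpart-box) by DOMINATED CONVERGENCE (needs the window-uniform
majorant — a signed inequality does not pass to the limit under Fatou); all need (L-lim-box) = [I] (1.21) «This limit exists».  None of the five finite-volume letters carries
a (5.10) rate or a volume rate; uniform-in-`K` windowed (5.10) with history-free constants (what [I]–[II] actually prove) pays (V-dom-ev), (V-absmom) and the domination half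
of (V-negpart) at once, and lens-1's [E] pays (V-ucauchy).  What it is NOT: none of the letters is proved, asserted, ported or discharged here; they are OPEN Bałaban-strength
content; K0ᴬ ∕ K1ᴬ ∕ K3ᴬ stay OPEN; NODE O 0∕1; finite 𝕋⁴ at fixed ε — not continuum ∕ OS ∕ Clay; the Yang–Mills mass gap is NOT proved by any of this.

JUNK CENSUS (CRIT-1 g36's J1′ test, nodeO STATUS l.4852, pre-applied): each of the four `def … : Prop` below is junk-TRUE exactly at `γ ≤ 0` (`Box γ k = ∅`) and nowhere else
cheaply (`recordPvolAx` is the PINNED name `K0RecordFormatNamesAx` :81; `m`, `e`, `W` must dominate ∕ floor ∕ exhaust against the pinned kernels); the door quantifies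
`0 < γ₀ ∧ γ₀ ≤ ½ ∧ 0 < ε₂₉`.
-/

open scoped BigOperators Matrix.Norms.L2Operator Topology
open Set Filter
open Summit.QuantumFields.YangMills.Theorems.K0RecordFormatNames
open Summit.QuantumFields.YangMills.Theorems
open Literature.MathematicalPhysics.QuantumFieldTheory.Balaban1983to89
open Literature.MathematicalPhysics.QuantumFieldTheory.Balaban1983to89.Node00
open Literature.MathematicalPhysics.QuantumFieldTheory.Balaban1983to89.T4Continuum (T4Family)
open Literature.MathematicalPhysics.QuantumFieldTheory.Balaban1983to89.FlowStep

namespace Summit.QuantumFields.YangMills.Theorems.K0AxMomentRoad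

variable (F : T4Family) (a₀ ε₂₉ : ℝ)

/-! ## §7a Generic: dominated convergence THROUGH AN EXHAUSTING WINDOW (the finite-volume sums are window-truncated, the limit sum is over all of `ℤ⁴`) -/

/-- **Dominated convergence through an exhausting window**: if `f K z → g z` for every `z`, the finite windows `W K` exhaust the index type, and on the windows the
terms are eventually dominated by ONE summable `m`, then the window sums `Σ_{z ∈ W K} f K z` converge to `Σ'_z g z`.  (Mathlib's `tendsto_tsum_of_dominated_convergence`
applied to the zero-extended window terms — the `ℤ⁴`-window form of the tree's moving-range Tannery theorem `T4LambdaMatching.tendsto_sum_range_of_dominated` (ranges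
`m < N_K` in `ℕ`); the tool that passes SIGNED finite-volume (1.22)-moments to the (1.21) limit — Fatou (`…K0AxMomentRoad`) only passes absolute ones.)
[cite: Balaban1987RG1, (1.21)–(1.22) p.264 (analysis bookkeeping for the volume limit of the β-moments)] -/
theorem tendsto_windowSum_of_dominated {Z : Type*} {f : ℕ → Z → ℝ} {g m : Z → ℝ} {W : ℕ → Finset Z}
    (hm : Summable m) (hW : ∀ z, ∀ᶠ K in atTop, z ∈ W K) (hlim : ∀ z, Tendsto (fun K => f K z) atTop (𝓝 (g z)))
    (hdom : ∀ᶠ K in atTop, ∀ z ∈ W K, |f K z| ≤ m z) :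
    Tendsto (fun K => ∑ z ∈ W K, f K z) atTop (𝓝 (∑' z, g z)) := by
  classical
  have hm0 : ∀ z, 0 ≤ m z := fun z => by
    obtain ⟨K, hK1, hK2⟩ := ((hW z).and hdom).exists
    exact (abs_nonneg _).trans (hK2 z hK1)
  have hF : (fun K => ∑ z ∈ W K, f K z) = fun K => ∑' z, (if z ∈ W K then f K z else 0) := by
    funext K
    rw [tsum_eq_sum (s := W K) (fun z hz => if_neg hz)]
    exact Finset.sum_congr rfl fun z hz => (if_pos hz).symm
  rw [hF]
  refine tendsto_tsum_of_dominated_convergence hm (fun z => ?_) ?_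
  · refine Tendsto.congr' ?_ (hlim z)
    filter_upwards [hW z] with K hK
    exact (if_pos hK).symm
  · filter_upwards [hdom] with K hK z
    by_cases hz : z ∈ W K
    · rw [if_pos hz, Real.norm_eq_abs]; exact hK z hz
    · rw [if_neg hz, norm_zero]; exact hm0 z

/-! ## §7b The FINITE-VOLUME letters (windowed kernels `recordPvolAx … K`, rate-free, per scale) -/

/-- **(V-dom-ev-box) — RECEIPT «PER-SCALE DOMINATION OF THE FINITE-VOLUME MOMENT TERMS, POINTWISE-EVENTUALLY IN THE VOLUME»**: at each scale `k` ONE summable `m_k` with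
`|Π^{T_K}_{k+1}(v; z)₀₁|·|z₀|·|z₁| ≤ m_k(z)` for every box history `v`, every `z`, and all large `K` (thresholds may depend on `z`, `v` — the shape of
`K0RecordFormatNamesDecay.PvolDecayEvOnBoxOf` with the (5.10) RATE REMOVED).  HYPOTHESIS SHAPE; the content is Bałaban's ([I] (4.37) p.291, (5.10) p.293), OPEN here.
[cite: Balaban1987RG1, (1.20)–(1.21) p.264, (4.37) p.291, (5.10) p.293] -/
def RecordPvolMomentDominatedEvOnBoxAx (γ : ℝ) : Prop :=
  ∀ k : ℕ, ∃ m : (Fin 4 → ℤ) → ℝ, Summable m ∧ ∀ (v : Fin (k + 1) → ℝ), v ∈ Box γ k →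
    ∀ z : Fin 4 → ℤ, ∀ᶠ K in atTop, |recordPvolAx F a₀ ε₂₉ k v K 0 1 z| * |(z 0 : ℝ)| * |(z 1 : ℝ)| ≤ m z

/-- **(V-cont-box) — RECEIPT «TERMWISE HISTORY-CONTINUITY OF THE FINITE-VOLUME ACTIVITIES»**: for each `k`, `z`, the entry `v ↦ Π^{T_K}_{k+1}(v; z)₀₁` is
continuous on the box — asked only for COFINALLY MANY volumes `K` (`∃ᶠ`, the weakest form Mathlib's `TendstoUniformlyOn.continuousOn` consumes; a finite-dimensional
integral's parameter dependence; [I] p.264 «smooth functions of g_j» is stated for the limit).  HYPOTHESIS SHAPE, OPEN here. [cite: Balaban1987RG1, (1.20)–(1.22) p.264] -/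
def RecordPvolContOnBoxAx (γ : ℝ) : Prop :=
  ∀ (k : ℕ) (z : Fin 4 → ℤ), ∃ᶠ K in atTop, ContinuousOn (fun v : Fin (k + 1) → ℝ => recordPvolAx F a₀ ε₂₉ k v K 0 1 z) (Box γ k)

/-- **(V-ucauchy-box) — RECEIPT «THE VOLUME LIMIT (1.21) IS UNIFORM IN THE BOX HISTORY», RATE-FREE TWO-VOLUME FORM**: for each `k`, `z` the finite-volume entries
`(K, v) ↦ Π^{T_K}_{k+1}(v; z)₀₁` are UNIFORMLY CAUCHY in `K` on the box — the two-volume comparison of [I] p.264 ∕ [II] without its exponential rate (compare the RATED run letter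
`K0AxTwoVolumeRate.RecordPvolTwoVolExpOnRunsAx`).  HYPOTHESIS SHAPE, OPEN here. [cite: Balaban1987RG1, (1.21) p.264 («This limit exists by the localized representation (1.7)»)] -/
def RecordPvolUniformCauchyOnBoxAx (γ : ℝ) : Prop :=
  ∀ (k : ℕ) (z : Fin 4 → ℤ), UniformCauchySeqOn (fun (K : ℕ) (v : Fin (k + 1) → ℝ) => recordPvolAx F a₀ ε₂₉ k v K 0 1 z) atTop (Box γ k)

/-- **(V-negpart-box) — RECEIPT «SUMMABLE NEGATIVE PARTS OF THE WINDOWED FINITE-VOLUME (1.22)-MOMENTS, WITH WINDOW-UNIFORM DOMINATION»**: `e ≥ 0` summable; at each scale `k`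
ONE summable majorant `m_k`; at every box history an exhausting window `W` on which, for all large `K`, the moment terms are dominated by `m_k` (uniformly in `z ∈ W K` — the
tightness that lets the SIGNED window moment pass to the volume limit) and, for cofinally many `K`, the signed window moment `Σ_{z ∈ W K} Π^{T_K}(v; z)₀₁ z₀ z₁ ≥ −e_k`.
HYPOTHESIS SHAPE (the finite-volume face of asymptotic freedom's sign, [I] Thm 2 (0.31) p.259, (5.44) p.297); OPEN here. [cite: Balaban1987RG1, Thm 2 (0.31) p.259, (1.20)–(1.22) p.264, (5.44) p.297] -/
def RecordPvolMomentNegPartOnBoxAx (γ : ℝ) (e : ℕ → ℝ) : Prop :=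
  (∀ k, 0 ≤ e k) ∧ Summable e ∧ ∀ k : ℕ, ∃ m : (Fin 4 → ℤ) → ℝ, Summable m ∧ ∀ (v : Fin (k + 1) → ℝ), v ∈ Box γ k →
    ∃ W : ℕ → Finset (Fin 4 → ℤ), (∀ z : Fin 4 → ℤ, ∀ᶠ K in atTop, z ∈ W K) ∧
      (∀ᶠ K in atTop, ∀ z ∈ W K, |recordPvolAx F a₀ ε₂₉ k v K 0 1 z| * |(z 0 : ℝ)| * |(z 1 : ℝ)| ≤ m z) ∧
      ∃ᶠ K in atTop, -e k ≤ ∑ z ∈ W K, recordPvolAx F a₀ ε₂₉ k v K 0 1 z * (z 0 : ℝ) * (z 1 : ℝ)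

/-! ## §7c Finite volume + (1.21) ⟹ the limit-kernel letters of §6 (termwise `le_of_tendsto`; uniform Cauchy ⟹ uniform limit ⟹ continuity; dominated convergence through the window) -/

/-- (V-negpart-box)'s built-in window-uniform domination implies the pointwise-eventual (V-dom-ev-box). [cite: Balaban1987RG1, (1.20)–(1.21) p.264 (bookkeeping)] -/
theorem recordPvolMomentDominatedEvOnBoxAx_of_negPart {γ : ℝ} {e : ℕ → ℝ} (h : RecordPvolMomentNegPartOnBoxAx F a₀ ε₂₉ γ e) :
    RecordPvolMomentDominatedEvOnBoxAx F a₀ ε₂₉ γ := by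
  intro k
  obtain ⟨m, hm, hb⟩ := h.2.2 k
  refine ⟨m, hm, fun v hv z => ?_⟩
  obtain ⟨W, hW, hdom, -⟩ := hb v hv
  filter_upwards [hW z, hdom] with K hz hK
  exact hK z hz

/-- **(L-lim-box) ∧ (V-dom-ev-box) ⟹ (L-dom-box)** (termwise: the limit of eventually dominated terms is dominated). [cite: Balaban1987RG1, (1.21) p.264, (5.10) p.293] -/
theorem recordPlimMomentDominatedOnBoxAx_of_pvol {γ : ℝ}
    (hlim : letI θ := thetaFill F a₀ ε₂₉
      letI := θ.instVβ₁; letI := θ.instVβ₂; letI := θ.instιβ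
      PolLimitOnBoxOf F (recordTermsAx F a₀ ε₂₉) θ.ρ8 θ.bV γ)
    (h : RecordPvolMomentDominatedEvOnBoxAx F a₀ ε₂₉ γ) : RecordPlimMomentDominatedOnBoxAx F a₀ ε₂₉ γ := by
  intro k
  obtain ⟨m, hm, hb⟩ := h k
  refine ⟨m, hm, fun v hv z => ?_⟩
  letI θ := thetaFill F a₀ ε₂₉
  letI := θ.instVβ₁; letI := θ.instVβ₂; letI := θ.instιβ
  have ht : Tendsto (fun K => |recordPvolAx F a₀ ε₂₉ k v K 0 1 z| * |(z 0 : ℝ)| * |(z 1 : ℝ)|) atTop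
      (𝓝 (|recordPlimAx F a₀ ε₂₉ k v 0 1 z| * |(z 0 : ℝ)| * |(z 1 : ℝ)|)) :=
    ((((continuous_abs.tendsto _).comp
      (tendsto_pvolOf F (recordTermsAx F a₀ ε₂₉) θ.ρ8 θ.bV k v (hlim k v hv) 0 1 z)).mul_const _).mul_const _)
  exact le_of_tendsto ht (hb v hv z)

/-- ★ **(L-lim-box) ∧ (V-cont-box) ∧ (V-ucauchy-box) ⟹ (L-cont-box)** (uniformly Cauchy + pointwise limit ⟹ uniform convergence on the box ⟹ the limit entry is continuous
in the history: `UniformCauchySeqOn.tendstoUniformlyOn_of_tendsto`, `TendstoUniformlyOn.continuousOn`).  So the junction's CONTINUITY row (C) is inheritable from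
finite volume WITHOUT a rate — the RATED form of this step is the β sub-cell's `Beta.BetaContinuityVolume.continuousOn_lim_of_volumeRate` ((C-fin) + a history-uniform
VOLUME RATE (VR-u) with moduli `ρ_t → 0`); here the modulus is replaced by bare uniform Cauchy-ness at the record names. [cite: Balaban1987RG1, (1.21)–(1.22) p.264] -/
theorem recordPlimContOnBoxAx_of_pvol {γ : ℝ}
    (hlim : letI θ := thetaFill F a₀ ε₂₉
      letI := θ.instVβ₁; letI := θ.instVβ₂; letI := θ.instιβ
      PolLimitOnBoxOf F (recordTermsAx F a₀ ε₂₉) θ.ρ8 θ.bV γ)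
    (hc : RecordPvolContOnBoxAx F a₀ ε₂₉ γ) (hu : RecordPvolUniformCauchyOnBoxAx F a₀ ε₂₉ γ) : RecordPlimContOnBoxAx F a₀ ε₂₉ γ := by
  intro k z
  letI θ := thetaFill F a₀ ε₂₉
  letI := θ.instVβ₁; letI := θ.instVβ₂; letI := θ.instιβ
  have hT : TendstoUniformlyOn (fun (K : ℕ) (v : Fin (k + 1) → ℝ) => recordPvolAx F a₀ ε₂₉ k v K 0 1 z)
      (fun v => recordPlimAx F a₀ ε₂₉ k v 0 1 z) atTop (Box γ k) :=
    (hu k z).tendstoUniformlyOn_of_tendsto fun v hv => tendsto_pvolOf F (recordTermsAx F a₀ ε₂₉) θ.ρ8 θ.bV k v (hlim k v hv) 0 1 z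
  exact hT.continuousOn (hc k z)

/-- ★ **(L-lim-box) ∧ (V-negpart-box e) ⟹ (L-negpart-box e)** (dominated convergence through the window passes the SIGNED window moments to the (1.22)-moment of the limit kernel,
`B12Beta.secondMoment … 0 1 = Σ'_z Π(z) z₀ z₁`; the cofinal sign bound survives by closedness of `[−e_k, ∞[`).  So the junction's FLOOR row (iv) is inheritable from finite volume
WITHOUT a rate, at the price of window-uniform domination (tightness) — absolute moments needed only Fatou. [cite: Balaban1987RG1, Thm 2 (0.31) p.259, (1.21)–(1.22) p.264, (5.44) p.297] -/
theorem recordPlimMomentNegPartOnBoxAx_of_pvol {γ : ℝ} {e : ℕ → ℝ}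
    (hlim : letI θ := thetaFill F a₀ ε₂₉
      letI := θ.instVβ₁; letI := θ.instVβ₂; letI := θ.instιβ
      PolLimitOnBoxOf F (recordTermsAx F a₀ ε₂₉) θ.ρ8 θ.bV γ)
    (h : RecordPvolMomentNegPartOnBoxAx F a₀ ε₂₉ γ e) : RecordPlimMomentNegPartOnBoxAx F a₀ ε₂₉ γ e := by
  refine ⟨h.1, h.2.1, fun k v hv => ?_⟩
  obtain ⟨m, hm, hb⟩ := h.2.2 k
  obtain ⟨W, hW, hdom, hfr⟩ := hb v hv
  letI θ := thetaFill F a₀ ε₂₉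
  letI := θ.instVβ₁; letI := θ.instVβ₂; letI := θ.instιβ
  have hlimz : ∀ z : Fin 4 → ℤ, Tendsto (fun K => recordPvolAx F a₀ ε₂₉ k v K 0 1 z * (z 0 : ℝ) * (z 1 : ℝ)) atTop
      (𝓝 (recordPlimAx F a₀ ε₂₉ k v 0 1 z * (z 0 : ℝ) * (z 1 : ℝ))) := fun z =>
    ((tendsto_pvolOf F (recordTermsAx F a₀ ε₂₉) θ.ρ8 θ.bV k v (hlim k v hv) 0 1 z).mul_const _).mul_const _
  have hdom' : ∀ᶠ K in atTop, ∀ z ∈ W K, |recordPvolAx F a₀ ε₂₉ k v K 0 1 z * (z 0 : ℝ) * (z 1 : ℝ)| ≤ m z := by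
    filter_upwards [hdom] with K hK z hz
    rw [abs_mul, abs_mul]
    exact hK z hz
  have ht := tendsto_windowSum_of_dominated hm hW hlimz hdom'
  exact isClosed_Ici.mem_of_frequently_of_tendsto hfr ht

/-! ## §7d ★★★ K0ᴬ by name from FINITE-VOLUME letters + (1.21) at cofinally small radii (every hypothesis a windowed-torus statement or the existence of the limit) -/

/-- ★★★ **K0ᴬ BY NAME FROM FINITE VOLUME, RATE-FREE**: at cofinally small radii `a₀ ≤ a`, ONE level `0 < γ₀ ≤ ½` and `0 < ε₂₉` with the (1.21) box letter (L-lim-box), the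
window-truncated absolute-moment letter (V-absmom-box) of `…K0AxMomentBox`, (V-cont-box), (V-ucauchy-box) and (V-negpart-box) `e` ⟹ `Theses.BalabanUVNodes.Record13SepCoPHInhabitedAx`
— through §6's ★★★ `record13SepCoPHInhabitedAx_of_plimBoxLetters_cofinalRadii` (Fatou for the |β| rows, uniform Cauchy for (C), dominated convergence for (iv)).  CONDITIONAL on the
displayed supply — OPEN Bałaban-strength content; K0ᴬ stmt-QuantumFields-27238 OPEN; the Yang–Mills mass gap is NOT proved.
[cite: Balaban1987RG1, Thm 1 p.259, Thm 2 (0.31) p.259, Thm 3 p.264, (1.20)–(1.22) p.264, (4.37) p.291, (5.42)–(5.44) p.297] -/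
theorem record13SepCoPHInhabitedAx_of_pvolBoxLetters_cofinalRadii
    (H : ∀ (F : T4Family) (a : ℝ), 0 < a → ∃ a₀ : ℝ, 0 < a₀ ∧ a₀ ≤ a ∧ ∃ (γ₀ ε₂₉ M : ℝ) (e : ℕ → ℝ), 0 < γ₀ ∧ γ₀ ≤ 1 / 2 ∧ 0 < ε₂₉ ∧
      (letI θ := thetaFill F a₀ ε₂₉
       letI := θ.instVβ₁; letI := θ.instVβ₂; letI := θ.instιβ
       PolLimitOnBoxOf F (recordTermsAx F a₀ ε₂₉) θ.ρ8 θ.bV γ₀) ∧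
      RecordPvolAbsMomentOnBoxAx F a₀ ε₂₉ γ₀ M ∧ RecordPvolContOnBoxAx F a₀ ε₂₉ γ₀ ∧ RecordPvolUniformCauchyOnBoxAx F a₀ ε₂₉ γ₀ ∧
        RecordPvolMomentNegPartOnBoxAx F a₀ ε₂₉ γ₀ e) :
    Summit.QuantumFields.YangMills.Theses.BalabanUVNodes.Record13SepCoPHInhabitedAx :=
  record13SepCoPHInhabitedAx_of_plimBoxLetters_cofinalRadii fun F a ha => by
    obtain ⟨a₀, ha₀, hle, γ₀, ε₂₉, M, e, hγ₀, hγh, hε, hlim, hV, hc, hu, hneg⟩ := H F a ha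
    exact ⟨a₀, ha₀, hle, γ₀, ε₂₉, M, e, hγ₀, hγh, hε, recordPlimAbsMomentOnBoxAx_of_pvol F a₀ ε₂₉ hlim hV,
      recordPlimContOnBoxAx_of_pvol F a₀ ε₂₉ hlim hc hu,
      recordPlimMomentDominatedOnBoxAx_of_pvol F a₀ ε₂₉ hlim (recordPvolMomentDominatedEvOnBoxAx_of_negPart F a₀ ε₂₉ hneg),
      recordPlimMomentNegPartOnBoxAx_of_pvol F a₀ ε₂₉ hlim hneg⟩

-- AXIOM CENSUS of the finite-volume rate-free door: standard axioms only (no `sorryAx`).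
#print axioms record13SepCoPHInhabitedAx_of_pvolBoxLetters_cofinalRadii

end Summit.QuantumFields.YangMills.Theorems.K0AxMomentRoad
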